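import Mathlib.Analysis.ODE.Gronwall
import Mathlib.MeasureTheory.Integral.IntervalIntegral.FundThmCalculus
import HarnessLib

/-!
# Sub-goal `engine_gronwall` of the lead's `stub_engine` (line `IdeatorTwoGen1Sketch`, crux `MacroClosure`,
stmt-AtomisticToContinuum-14870): Gronwall's inequality in integral form

For a non-negative function `a`, integrable on `[0,t]`, with `a(s) ≤ A + B ∫_{[0,s]} a` for all `s ≤ t`
(`B ≥ 0`), one has `a(s) ≤ A e^{Bs}`. Proof: `F(s) = ∫_{[0,s]} a` is continuous and satisfies
`F(s) ≤ A s + B H(s)` with `H(s) = ∫₀ˢ F`; the shifted primitive `J = H + (A/B²)(1 + Bs)` satisfies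
`J' ≤ B J`, `J ≥ 0`, so Mathlib's differential Gronwall bound gives `J(s) ≤ (A/B²) e^{Bs}`, whence
`F(s) ≤ (A/B)(e^{Bs} − 1)` and `a(s) ≤ A + B F(s) ≤ A e^{Bs}`. This is the scalar inequality that closes the
barycentric Gronwall on `δ' − ℓ_N`.
-/

noncomputable section

open MeasureTheory Filter Set Topology intervalIntegral

namespace Summit.AtomisticToContinuum.HydrodynamicLimit.Theorems.MacroClosureLine

namespace Barycentric

namespace Gronwall

/-- The primitive over `Icc 0 s` equals the interval integral `∫ τ in 0..s` for `0 ≤ s`. -/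
theorem setIntegral_Icc_eq_intervalIntegral (a : ℝ → ℝ) {s : ℝ} (hs : 0 ≤ s) :
    ∫ τ in Icc 0 s, a τ = ∫ τ in (0 : ℝ)..s, a τ := by
  rw [intervalIntegral.integral_of_le hs, integral_Icc_eq_integral_Ioc]

end Gronwall

open Gronwall in
/-- **`engine_gronwall` (registered sub-goal of `stub_engine`): Gronwall's inequality in integral form** for a
non-negative integrable function on `[0,t]`: `a(s) ≤ A + B∫_{[0,s]} a` for all `s ≤ t` implies
`a(s) ≤ A e^{Bs}`. [folklore] -/
theorem engine_gronwall : ∀ (a : ℝ → ℝ) (A B t : ℝ), 0 ≤ B → 0 ≤ t → (∀ s ∈ Icc 0 t, 0 ≤ a s) →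
    IntegrableOn a (Icc 0 t) → (∀ s ∈ Icc 0 t, a s ≤ A + B * ∫ τ in Icc 0 s, a τ) →
    ∀ s ∈ Icc 0 t, a s ≤ A * Real.exp (B * s) := by
  intro a A B t hB ht ha0 hint hineq s hs
  -- `A ≥ 0` (from the inequality at `s = 0`)
  have hA : 0 ≤ A := by
    have h0 := hineq 0 ⟨le_rfl, ht⟩
    have hz : ∫ τ in Icc (0 : ℝ) 0, a τ = 0 := by
      rw [Icc_self, Measure.restrict_singleton]; simp
    rw [hz, mul_zero, add_zero] at h0
    exact (ha0 0 ⟨le_rfl, ht⟩).trans h0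
  -- the case `B = 0`
  rcases hB.eq_or_lt with hB0 | hBpos
  · have := hineq s hs
    rw [← hB0, zero_mul, add_zero] at this
    rw [← hB0, zero_mul, Real.exp_zero, mul_one]
    exact this
  -- integrability on sub-intervals and the primitive `F`
  have hint' : IntervalIntegrable a volume 0 t := by
    rw [intervalIntegrable_iff_integrableOn_Icc_of_le ht]; exact hint
  set F : ℝ → ℝ := fun r => ∫ τ in (0 : ℝ)..r, a τ with hF
  have hintu : IntegrableOn a (uIcc 0 t) := by rwa [uIcc_of_le ht]
  have hFcont : ContinuousOn F (Icc 0 t) := by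
    have := intervalIntegral.continuousOn_primitive_interval (μ := volume) (a := 0) (b := t) hintu
    simpa [hF, uIcc_of_le ht] using this
  have hF_eq : ∀ r ∈ Icc 0 t, ∫ τ in Icc 0 r, a τ = F r := fun r hr =>
    setIntegral_Icc_eq_intervalIntegral a hr.1
  have hF0 : ∀ r ∈ Icc 0 t, 0 ≤ F r := by
    intro r hr
    rw [← hF_eq r hr]
    exact setIntegral_nonneg measurableSet_Icc fun τ hτ => ha0 τ ⟨hτ.1, hτ.2.trans hr.2⟩
  -- the primitive of `F`: `H r = ∫₀ʳ F`
  set H : ℝ → ℝ := fun r => ∫ τ in (0 : ℝ)..r, F τ with hH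
  have hFint : ∀ r ∈ Icc 0 t, IntervalIntegrable F volume 0 r := fun r hr =>
    (hFcont.mono (Icc_subset_Icc le_rfl hr.2)).intervalIntegrable_of_Icc hr.1
  have hHderiv : ∀ r ∈ Ico 0 t, HasDerivWithinAt H (F r) (Ici r) r := by
    intro r hr
    have hmeas : StronglyMeasurableAtFilter F (𝓝[>] r) volume := by
      have hsub : Ioo r t ∈ 𝓝[>] r := Ioo_mem_nhdsGT hr.2
      refine ⟨Ioo r t, hsub, ?_⟩
      exact (hFcont.mono fun x hx => ⟨hr.1.trans hx.1.le, hx.2.le⟩).aestronglyMeasurable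
        measurableSet_Ioo
    have hcont : ContinuousWithinAt F (Ioi r) r := by
      have h1 : ContinuousWithinAt F (Icc 0 t) r := hFcont r ⟨hr.1, hr.2.le⟩
      have h2 : Icc r t ∈ 𝓝[Ici r] r := Icc_mem_nhdsGE hr.2
      have h3 : ContinuousWithinAt F (Ici r) r :=
        h1.mono_of_mem_nhdsWithin (Filter.mem_of_superset h2 (Icc_subset_Icc hr.1 le_rfl))
      exact h3.mono Ioi_subset_Ici_self
    have := intervalIntegral.integral_hasDerivWithinAt_right (s := Ici r) (t := Ioi r)
      (hFint r ⟨hr.1, hr.2.le⟩) hmeas hcont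
    simpa [hH] using this
  have hHcont : ContinuousOn H (Icc 0 t) := by
    have hFu : IntegrableOn F (uIcc 0 t) := by
      rw [uIcc_of_le ht]
      exact hFcont.integrableOn_compact isCompact_Icc
    have := intervalIntegral.continuousOn_primitive_interval (μ := volume) (a := 0) (b := t) hFu
    simpa [hH, uIcc_of_le ht] using this
  have hH0 : H 0 = 0 := by simp [hH]
  have hHnn : ∀ r ∈ Icc 0 t, 0 ≤ H r := by
    intro r hr
    show 0 ≤ ∫ τ in (0 : ℝ)..r, F τ
    exact intervalIntegral.integral_nonneg hr.1 fun τ hτ => hF0 τ ⟨hτ.1, hτ.2.trans hr.2⟩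
  -- `F r ≤ A r + B H r`
  have hFle : ∀ r ∈ Icc 0 t, F r ≤ A * r + B * H r := by
    intro r hr
    have hsub : ∀ τ ∈ Icc 0 r, τ ∈ Icc 0 t := fun τ hτ => ⟨hτ.1, hτ.2.trans hr.2⟩
    have h1 : ∫ τ in (0 : ℝ)..r, a τ ≤ ∫ τ in (0 : ℝ)..r, (A + B * F τ) := by
      refine intervalIntegral.integral_mono_on hr.1 (hint'.mono_set ?_)
        ((intervalIntegrable_const).add ((hFint r hr).const_mul B)) fun τ hτ => ?_
      · rw [uIcc_of_le ht, uIcc_of_le hr.1]; exact Icc_subset_Icc le_rfl hr.2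
      · rw [← hF_eq τ (hsub τ hτ)]; exact hineq τ (hsub τ hτ)
    have h2 : ∫ τ in (0 : ℝ)..r, (A + B * F τ) = A * r + B * H r := by
      rw [intervalIntegral.integral_add intervalIntegrable_const ((hFint r hr).const_mul B),
        intervalIntegral.integral_const, intervalIntegral.integral_const_mul]
      simp [hH, mul_comm]
    calc F r = ∫ τ in (0 : ℝ)..r, a τ := rfl
      _ ≤ _ := h1
      _ = _ := h2
  -- the shifted primitive `J = H + (A/B²)(1 + B r)` and the differential Gronwall bound
  set J : ℝ → ℝ := fun r => H r + A / B ^ 2 * (1 + B * r) with hJ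
  have hJderiv : ∀ r ∈ Ico 0 t, HasDerivWithinAt J (F r + A / B) (Ici r) r := by
    intro r hr
    have h1 := hHderiv r hr
    have h2 : HasDerivWithinAt (fun r => A / B ^ 2 * (1 + B * r)) (A / B) (Ici r) r := by
      have h3 : HasDerivAt (fun r => A / B ^ 2 * (1 + B * r)) (A / B ^ 2 * (B * 1)) r :=
        (((hasDerivAt_id r).const_mul B).const_add 1).const_mul (A / B ^ 2)
      have e : A / B ^ 2 * (B * 1) = A / B := by
        have hBne : B ≠ 0 := hBpos.ne'
        field_simp
      rw [← e]
      exact h3.hasDerivWithinAt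
    exact h1.add h2
  have hJnn : ∀ r ∈ Icc 0 t, 0 ≤ J r := fun r hr => by
    have := hHnn r hr
    have : 0 ≤ A / B ^ 2 * (1 + B * r) := by
      apply mul_nonneg (div_nonneg hA (sq_nonneg _)); nlinarith [hr.1]
    simp only [hJ]; linarith
  have hJcont : ContinuousOn J (Icc 0 t) := hHcont.add (by fun_prop)
  have hJ0 : ‖J 0‖ ≤ A / B ^ 2 := by
    simp only [hJ, hH0, mul_zero, add_zero, mul_one, zero_add]
    rw [Real.norm_of_nonneg (div_nonneg hA (sq_nonneg _))]
  have hbound : ∀ r ∈ Ico 0 t, ‖F r + A / B‖ ≤ B * ‖J r‖ + 0 := by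
    intro r hr
    have hr' : r ∈ Icc 0 t := ⟨hr.1, hr.2.le⟩
    have hFr := hF0 r hr'
    rw [Real.norm_of_nonneg (by positivity), Real.norm_of_nonneg (hJnn r hr'), add_zero]
    have := hFle r hr'
    simp only [hJ]
    have hBne : B ≠ 0 := hBpos.ne'
    have key : B * (H r + A / B ^ 2 * (1 + B * r)) = B * H r + A / B + A * r := by
      field_simp; ring
    rw [key]; linarith
  have hG := norm_le_gronwallBound_of_norm_deriv_right_le hJcont hJderiv hJ0 hbound s hs
  rw [gronwallBound_ε0, sub_zero] at hG
  -- unwind: `H s ≤ (A/B²)(e^{Bs} − 1 − Bs)`, `F s ≤ (A/B)(e^{Bs} − 1)`, `a s ≤ A e^{Bs}`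
  have hJs : J s ≤ A / B ^ 2 * Real.exp (B * s) := by
    have := (Real.norm_of_nonneg (hJnn s hs)).symm.le.trans hG
    simpa using this
  have hHs : B * H s ≤ A / B * (Real.exp (B * s) - 1) - A * s := by
    have hBne : B ≠ 0 := hBpos.ne'
    simp only [hJ] at hJs
    have h1 : B * H s + A / B * (1 + B * s) ≤ A / B * Real.exp (B * s) := by
      have h2 := mul_le_mul_of_nonneg_left hJs hB
      have e1 : B * (H s + A / B ^ 2 * (1 + B * s)) = B * H s + A / B * (1 + B * s) := by
        field_simp
      have e2 : B * (A / B ^ 2 * Real.exp (B * s)) = A / B * Real.exp (B * s) := by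
        field_simp
      rw [e1, e2] at h2; exact h2
    have e3 : A / B * (1 + B * s) = A / B + A * s := by field_simp
    have e4 : A / B * (Real.exp (B * s) - 1) = A / B * Real.exp (B * s) - A / B := by ring
    rw [e4]; linarith
  have hFs : F s ≤ A / B * (Real.exp (B * s) - 1) := by linarith [hFle s hs]
  calc a s ≤ A + B * ∫ τ in Icc 0 s, a τ := hineq s hs
    _ = A + B * F s := by rw [hF_eq s hs]
    _ ≤ A + B * (A / B * (Real.exp (B * s) - 1)) := by nlinarith [mul_le_mul_of_nonneg_left hFs hB]
    _ = A * Real.exp (B * s) := by field_simp; ring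

end Barycentric

end Summit.AtomisticToContinuum.HydrodynamicLimit.Theorems.MacroClosureLine

end
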